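import Literature.AlgebraicTopology.CharacteristicClasses.ProjectivizationCharts
import Literature.AlgebraicTopology.SingularHomology.CohomologyHomotopyInvariance
import Mathlib.Analysis.Normed.Module.Connected
import Mathlib.LinearAlgebra.Complex.FiniteDimensional
import HarnessLib

/-!
# `ℙ(A ⊕ 1)` acts trivially on the cohomology of `ℙ(L ⊕ ℂ)` for an automorphism `A` of a complex line `L`

The transition functions of the projective completion `P(λ ⊕ ℂ)` of a complex line bundle `λ`
are the projectivisations `ℙ(g(b) ⊕ 1)` of the transition scalars `g(b) ∈ ℂ^× = GL₁(ℂ)`; since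
`ℂ^×` is path connected (Husemoller, *Fibre Bundles*, Ch. 7 §4 / Ch. 17 §3: the structure group
of a complex line bundle is the connected group `ℂ^*`; Milnor–Stasheff §14 p. 156: "the complex
structure determines a preferred orientation of the fibres"), `ℙ(g ⊕ 1)` is homotopic to the
identity and so induces the identity on cohomology — the reason why the local generators of
`H²` of the fibres of `P(λ ⊕ ℂ)` are compatible (orientability of complex bundles).

## Content (all proved)

* `continuous_projectivizationMap₂` — **joint continuity of `(x, ℓ) ↦ ℙ(g x) ℓ`** for a family of
  injective linear maps with `(x, v) ↦ g x v` jointly continuous (through the open quotient map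
  `𝟙 × (v ↦ [v])`);
* `diagMap c = c ⊕ 1` on `F × ℂ`, `projDiag c : C(ℙ(F ⊕ ℂ), ℙ(F ⊕ ℂ))` for `c ≠ 0`, and
  **`projDiag_homotopic_id`**: `ℙ(c ⊕ 1) ≃ 𝟙` (a path from `c` to `1` in `ℂ^×`);
  `map_projDiag_eq_id` — it is the identity on `Hⁿ(ℙ(F ⊕ ℂ); M)`;
* `exists_eq_smul_of_finrank_eq_one` — an endomorphism of a line is a scalar; hence
  **`map_projProdOne_eq_id`**: for `dim F = 1` and any automorphism `A` of `F`, `ℙ(A ⊕ 1)`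
  induces the identity on `Hⁿ(ℙ(F ⊕ ℂ); M)`.

## References

* D. Husemoller, *Fibre Bundles*, 3rd ed., GTM 20, Springer 1994, Ch. 17 §2–§3.
  [HusemollerFibreBundles1994]
* J. Milnor, J. Stasheff, *Characteristic Classes*, PUP 1974, §14 p. 156. [MilnorStasheff1974]
-/

noncomputable section

open CategoryTheory Function Set Literature.AlgebraicTopology.SingularHomology
open scoped LinearAlgebra.Projectivization unitInterval

universe u v w

namespace Literature.AlgebraicTopology.CharacteristicClasses

/-! ### Joint continuity of families of projectivised linear maps -/

section Joint

variable {K : Type u} [DivisionRing K] {V : Type v} [AddCommGroup V] [Module K V]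
  [TopologicalSpace V] [ContinuousConstSMul K V] {W : Type w} [AddCommGroup W] [Module K W]
  [TopologicalSpace W]

omit [TopologicalSpace V] [ContinuousConstSMul K V] [TopologicalSpace W] in
/-- `ℙ(f) p = ℙ(g) p` for equal linear maps (rewriting helper for the proof-carrying `map`). [folklore] -/
theorem Projectivization.map_congr {f g : V →ₗ[K] W} (h : f = g) (hf : Injective f) (hg : Injective g)
    (p : ℙ K V) : Projectivization.map f hf p = Projectivization.map g hg p := by
  subst h
  rfl

/-- **`(x, ℓ) ↦ ℙ(g x) ℓ` is jointly continuous** when `(x, v) ↦ g x v` is (test after the open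
quotient map `𝟙 × (v ↦ [v])`, where the map is `(x, v) ↦ [g x v]`). [folklore] -/
theorem continuous_projectivizationMap₂ {X : Type*} [TopologicalSpace X] (g : X → V →ₗ[K] W)
    (hg : ∀ x, Injective (g x)) (hc : Continuous fun p : X × V ↦ g p.1 p.2) :
    Continuous fun p : X × ℙ K V ↦ Projectivization.map (g p.1) (hg p.1) p.2 := by
  have hq : IsOpenQuotientMap
      (Prod.map (@id X) fun v : {v : V // v ≠ 0} ↦ Projectivization.mk K v.1 v.2) :=
    IsOpenQuotientMap.id.prodMap Projectivization.isOpenQuotientMap_mk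
  rw [hq.isQuotientMap.continuous_iff]
  have h0 : ∀ p : X × {v : V // v ≠ 0}, g p.1 p.2.1 ≠ 0 := fun p h ↦
    p.2.2 ((hg p.1) (by rw [h, map_zero]))
  have heq : ((fun p : X × ℙ K V ↦ Projectivization.map (g p.1) (hg p.1) p.2) ∘
      Prod.map (@id X) fun v : {v : V // v ≠ 0} ↦ Projectivization.mk K v.1 v.2) =
        fun p ↦ Projectivization.mk K (g p.1 p.2.1) (h0 p) := by
    funext p
    obtain ⟨x, v⟩ := p
    change Projectivization.map (g x) (hg x) (Projectivization.mk K v.1 v.2) = _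
    rw [Projectivization.map_mk]
  rw [heq]
  exact (hc.comp (continuous_fst.prodMk (continuous_subtype_val.comp continuous_snd))).projectivizationMk h0

end Joint

/-! ### `ℙ(c ⊕ 1)` is homotopic to the identity -/

section Scalar

variable (F : Type v) [NormedAddCommGroup F] [NormedSpace ℂ F]

/-- `c ⊕ 1 : F × ℂ → F × ℂ`, `(v, t) ↦ (c v, t)`. [folklore] -/
def diagMap (c : ℂ) : (F × ℂ) →ₗ[ℂ] (F × ℂ) := (c • LinearMap.id).prodMap LinearMap.id

/-- `(c ⊕ 1)(v, t) = (c v, t)`. [folklore] -/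
@[simp]
theorem diagMap_apply (c : ℂ) (p : F × ℂ) : diagMap F c p = (c • p.1, p.2) := rfl

/-- `1 ⊕ 1 = 𝟙`. [folklore] -/
theorem diagMap_one : diagMap F 1 = LinearMap.id := by
  ext p <;> simp [diagMap]

/-- `c ⊕ 1` is injective for `c ≠ 0`. [folklore] -/
theorem diagMap_injective {c : ℂ} (hc : c ≠ 0) : Injective (diagMap F c) := by
  rintro ⟨v, t⟩ ⟨v', t'⟩ h
  simp only [diagMap_apply, Prod.mk.injEq] at h
  exact Prod.ext (smul_right_injective F hc h.1) h.2

/-- `(c, (v, t)) ↦ (c v, t)` is jointly continuous. [folklore] -/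
theorem continuous_diagMap₂ : Continuous fun p : ℂ × (F × ℂ) ↦ diagMap F p.1 p.2 :=
  (continuous_fst.smul (continuous_fst.comp continuous_snd)).prodMk (continuous_snd.comp continuous_snd)

/-- **`ℙ(c ⊕ 1) : ℙ(F ⊕ ℂ) → ℙ(F ⊕ ℂ)`** as a continuous map, `c ≠ 0`. [folklore] -/
def projDiag {c : ℂ} (hc : c ≠ 0) : C(ℙ ℂ (F × ℂ), ℙ ℂ (F × ℂ)) where
  toFun := Projectivization.map (diagMap F c) (diagMap_injective F hc)
  continuous_toFun := continuous_map (diagMap F c) (diagMap_injective F hc)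
    ((continuous_fst.const_smul c).prodMk continuous_snd)

/-- `projDiag` is `ℙ(c ⊕ 1)`. [folklore] -/
@[simp]
theorem projDiag_apply {c : ℂ} (hc : c ≠ 0) (p : ℙ ℂ (F × ℂ)) :
    projDiag F hc p = Projectivization.map (diagMap F c) (diagMap_injective F hc) p := rfl

/-- `ℂ^×` is path connected: a path from `c ≠ 0` to `1` avoiding `0`. [folklore] -/
theorem exists_path_ne_zero {c : ℂ} (hc : c ≠ 0) : ∃ γ : Path c 1, ∀ t, γ t ≠ 0 := by
  have hpc : IsPathConnected ({0}ᶜ : Set ℂ) :=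
    isPathConnected_compl_singleton_of_one_lt_rank (by rw [Complex.rank_real_complex]; norm_num) 0
  have hj : JoinedIn ({0}ᶜ : Set ℂ) c 1 := hpc.joinedIn c hc 1 one_ne_zero
  exact ⟨hj.somePath, fun t ↦ hj.somePath_mem t⟩

/-- **`ℙ(c ⊕ 1) ≃ 𝟙`** for `c ≠ 0`: move `c` to `1` inside `ℂ^×` (Husemoller Ch. 17 §3; the
connectedness of the structure group `ℂ^*` of a complex line bundle). [cite: HusemollerFibreBundles1994, Ch. 17 §3] -/
theorem projDiag_homotopic_id {c : ℂ} (hc : c ≠ 0) :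
    (projDiag F hc).Homotopic (ContinuousMap.id (ℙ ℂ (F × ℂ))) := by
  obtain ⟨γ, hγ⟩ := exists_path_ne_zero hc
  refine ⟨{ toFun := fun p ↦ Projectivization.map (diagMap F (γ p.1)) (diagMap_injective F (hγ p.1)) p.2
            continuous_toFun := continuous_projectivizationMap₂ (fun t : I ↦ diagMap F (γ t))
              (fun t ↦ diagMap_injective F (hγ t))
              ((continuous_diagMap₂ F).comp ((γ.continuous.comp continuous_fst).prodMk continuous_snd))
            map_zero_left := fun p ↦ ?_
            map_one_left := fun p ↦ ?_ }⟩
  · change Projectivization.map (diagMap F (γ 0)) (diagMap_injective F (hγ 0)) p =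
      Projectivization.map (diagMap F c) (diagMap_injective F hc) p
    exact Projectivization.map_congr (by rw [γ.source]) (diagMap_injective F (hγ 0)) (diagMap_injective F hc) p
  · change Projectivization.map (diagMap F (γ 1)) (diagMap_injective F (hγ 1)) p = p
    rw [Projectivization.map_congr (g := LinearMap.id) (by rw [γ.target, diagMap_one]) (diagMap_injective F (hγ 1))
      (LinearEquiv.refl ℂ (F × ℂ)).injective p, Projectivization.map_id]
    rfl

variable (R : Type w) [CommRing R] (M : Type w) [AddCommGroup M] [Module R M]

/-- **`ℙ(c ⊕ 1)` induces the identity on `Hⁿ(ℙ(F ⊕ ℂ); M)`.** [cite: HusemollerFibreBundles1994, Ch. 17 §3] -/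
theorem map_projDiag_eq_id {c : ℂ} (hc : c ≠ 0) (n : ℕ) :
    singularCohomology.map R M (projDiag F hc) n = 𝟙 _ := by
  rw [singularCohomology.map_eq_of_homotopic' R M (projDiag_homotopic_id F hc) n, singularCohomology.map_id]

end Scalar

/-! ### Automorphisms of a line are scalars -/

section Line

variable {F : Type v} [NormedAddCommGroup F] [NormedSpace ℂ F]

/-- **An endomorphism of a one-dimensional space is a scalar.** [folklore] -/
theorem exists_eq_smul_of_finrank_eq_one (hF : Module.finrank ℂ F = 1) (A : F →ₗ[ℂ] F) :
    ∃ c : ℂ, A = c • LinearMap.id := by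
  obtain ⟨v, hv, hspan⟩ := (finrank_eq_one_iff' (K := ℂ) (V := F)).1 hF
  obtain ⟨c, hc⟩ := hspan (A v)
  refine ⟨c, LinearMap.ext fun w ↦ ?_⟩
  obtain ⟨d, rfl⟩ := hspan w
  rw [map_smul, ← hc, LinearMap.smul_apply, LinearMap.id_apply, smul_comm]

/-- For an automorphism the scalar is nonzero. [folklore] -/
theorem exists_eq_smul_ne_zero_of_finrank_eq_one (hF : Module.finrank ℂ F = 1) (A : F ≃L[ℂ] F) :
    ∃ c : ℂ, c ≠ 0 ∧ ((A : F →L[ℂ] F) : F →ₗ[ℂ] F) = c • LinearMap.id := by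
  obtain ⟨c, hc⟩ := exists_eq_smul_of_finrank_eq_one hF ((A : F →L[ℂ] F) : F →ₗ[ℂ] F)
  refine ⟨c, fun h0 ↦ ?_, hc⟩
  obtain ⟨v, hv, -⟩ := (finrank_eq_one_iff' (K := ℂ) (V := F)).1 hF
  have : A v = 0 := by
    change ((A : F →L[ℂ] F) : F →ₗ[ℂ] F) v = 0
    rw [hc, h0, zero_smul, LinearMap.zero_apply]
  exact hv (A.injective (this.trans (map_zero A).symm))

/-- `(A ⊕ 1) = (c ⊕ 1)` for `A = c`. [folklore] -/
theorem prodMap_eq_diagMap {A : F →ₗ[ℂ] F} {c : ℂ} (h : A = c • LinearMap.id) :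
    A.prodMap (LinearMap.id : ℂ →ₗ[ℂ] ℂ) = diagMap F c := by
  rw [diagMap, h]

variable (R : Type w) [CommRing R] (M : Type w) [AddCommGroup M] [Module R M]

/-- **`ℙ(A ⊕ 1)` induces the identity on `Hⁿ(ℙ(F ⊕ ℂ); M)` for every automorphism `A` of a complex
LINE `F`** (it is `ℙ(c ⊕ 1) ≃ 𝟙`). The continuous-map structure on `ℙ(A ⊕ 1)` is arbitrary
(only the underlying function matters). [cite: HusemollerFibreBundles1994, Ch. 17 §3] -/
theorem map_projProdOne_eq_id (hF : Module.finrank ℂ F = 1) (A : F ≃L[ℂ] F)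
    (f : C(ℙ ℂ (F × ℂ), ℙ ℂ (F × ℂ)))
    (hf : ⇑f = Projectivization.map (((A : F →L[ℂ] F) : F →ₗ[ℂ] F).prodMap (LinearMap.id : ℂ →ₗ[ℂ] ℂ))
      ((A.injective.prodMap injective_id))) (n : ℕ) :
    singularCohomology.map R M f n = 𝟙 _ := by
  obtain ⟨c, hc, hA⟩ := exists_eq_smul_ne_zero_of_finrank_eq_one hF A
  have hfd : f = projDiag F hc := by
    ext p
    rw [hf, projDiag_apply]
    exact Projectivization.map_congr (prodMap_eq_diagMap hA) _ _ p
  rw [hfd, map_projDiag_eq_id]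

end Line

end Literature.AlgebraicTopology.CharacteristicClasses
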